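import Mathlib.Analysis.SpecialFunctions.Pow.Real
import Mathlib.Analysis.SpecialFunctions.Log.Base
import Summits.MatrixMultiplication.MatrixMultiplication.Statement
import Literature.Computability.AlgebraicComplexity.LaserMethodTheorem
import Literature.Computability.AlgebraicComplexity.AsymptoticSpectrumDuality
import Literature.Computability.AlgebraicComplexity.AsymptoticRankBorderRank
import Literature.Computability.AlgebraicComplexity.BorderRankCWDischarge
import Literature.Barriers.MatrixMultiplication.IrreversibilityBarrierThm19
import Literature.Barriers.MatrixMultiplication.UniversalMethodBarrierAsymptoticRank
import Literature.Barriers.MatrixMultiplication.UnstableTensorBarrierThm17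
import Summits.MatrixMultiplication.MatrixMultiplication.Theorems.SoloInformedCwTwoSubrank

/-!
# The door `R̃(T_{cw,2}) ≤ 3 ⇒ ω = 2`, stated over the tree's spectral constants

The one surviving line to `ω = 2` through a FIXED small tensor is the small Coppersmith–Winograd
tensor `T_{cw,2} ∈ (ℂ³)^{⊗3}`: Bürgisser–Clausen–Shokrollahi, Ex. 15.24(7) / Conner–Gesmundo–
Landsberg–Ventura 2022, p. 3 ("were `R̃(T_cw,2) = 3`, then Theorem 1.1 would imply `ω = 2`").
The tree proves Coppersmith–Winograd's theorem in the rank form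
(`CoppersmithWinograd1990_rank_form_holds`: `ω ≤ log_q((4/27) R(T_cw,q^{⊠k})^{3/k})`) and Strassen
duality for the asymptotic rank (`strassen_duality_asymptoticRank_holds`: `R̃(t) = max_{F ∈ Δ} F(t)`).
This file assembles from them the door itself as kernel theorems about the constants
`asymptoticRank`, `asymptoticSubrank`, `IsUniversalSpectralPoint` of `AsymptoticSpectrum.lean`:

* `omega_le_logb_of_asymptoticRank_cwTensor_lt` — `ω(ℂ) ≤ log_q(4ρ³/27)` for every
  `ρ > R̃(T_cw,q)`, `q ≥ 2` (BCS Ex. 15.24(7) with the tree's `R̃`);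
* `omega_le_two_of_asymptoticRank_cwTensor_two_le_three`,
  `matrixMultiplication_of_asymptoticRank_cwTensor_two_le_three` — **the door**:
  `R̃(T_cw,2) ≤ 3 ⇒ ω(ℂ) = 2` (`MatrixMultiplication`);
* `matrixMultiplication_of_forall_spectralPoint_cwTensor_two_le_three` — **spectral form**: if every
  universal spectral point `F ∈ Δ(T(ℂ))` has `F(T_cw,2) ≤ 3` then `ω = 2`; and
  `forall_spectralPoint_cwTensor_two_le_iff` — this hypothesis is EQUIVALENT to `R̃(T_cw,2) ≤ 3`;
* the sandwich in which the door sits (`cwTensor_two_spectral_sandwich`; the two `R̃` bounds are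
  private helpers here — the same names are declared elsewhere in the tree):
  `3 ≤ R̃(T_cw,2) ≤ 4` (flattening rank `3`; border rank `4`),
  `√6 ≤ Q̃(T_cw,2) ≤ 3` (the zeroing-out square certificate of `SoloInformedCwTwoSubrank.lean`;
  flattening bound), so the door asks for `R̃(T_cw,2)` to take the least value the flattenings allow,
  and every known spectral point (gauge points, quantum functionals) already takes the value `3` there.

What is NOT proved anywhere (the open content of the door): an upper bound `R̃(T_cw,2) < 4` in the
kernel (in print: `R̃(T_cw,2) ≤ 3.9310`, Alman–Li 2026), let alone `= 3`.

[cite: ConnerGesmundoLandsbergVentura2022, Thm. 1.1 and p. 3]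
[cite: BurgisserClausenShokrollahi1997, Ex. 15.24(7), Lemma (15.27)]
[cite: ChristandlVranaZuiddam2023, Prop. 1.6, Example 1.4]
[cite: ChristandlVranaZuiddam2021, §3.1 (after Thm. 9: the barrier is `2` at `q = 2`)]
-/

noncomputable section

namespace Summit.MatrixMultiplication.MatrixMultiplication.Theorems

open Literature.Computability.AlgebraicComplexity
open Literature.Barriers.MatrixMultiplication (flatteningRank_cwTensor flatteningRank_le_asymptoticRank
  asymptoticSubrank_le_card₁₂₃)

/-! ## `ω ≤ log_q(4ρ³/27)` for every `ρ > R̃(T_cw,q)` -/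

/-- **Coppersmith–Winograd via the asymptotic rank** (BCS Ex. 15.24(7); CGLV 2022 p. 3), over the
tree's constant `asymptoticRank`: for `q ≥ 2` and every real `ρ > R̃(T_cw,q)`,
`ω(ℂ) ≤ log_q(4ρ³/27)`. Proof: `R̃` is an infimum, so some power has `R(T_cw,q^{⊠N₀}) ≤ ρ^{N₀}`
(`exists_tensorRank_kroneckerPow_mul_le`); apply the proved rank form
`CoppersmithWinograd1990_rank_form_holds` at `k = N₀` and monotonicity of `log_q`.
[cite: ConnerGesmundoLandsbergVentura2022, Thm. 1.1 and p. 3] -/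
theorem omega_le_logb_of_asymptoticRank_cwTensor_lt {q : ℕ} (hq : 2 ≤ q) {ρ : ℝ}
    (hρ : asymptoticRank (cwTensor ℂ q) < ρ) :
    omega ℂ ≤ Real.logb q (4 * ρ ^ 3 / 27) := by
  have hq1 : 1 ≤ q := by omega
  have hε : 0 < ρ - asymptoticRank (cwTensor ℂ q) := sub_pos.2 hρ
  have hρ0 : 0 < ρ := lt_of_le_of_lt (asymptoticRank_nonneg _) hρ
  obtain ⟨N₀, hN₀, hpow⟩ := exists_tensorRank_kroneckerPow_mul_le (cwTensor ℂ q) hε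
  have hR : (tensorRank (kroneckerPow (cwTensor ℂ q) N₀) : ℝ) ≤ ρ ^ N₀ := by
    have h := hpow 1
    rw [mul_one, add_sub_cancel] at h
    exact h
  have hR1 : (1 : ℝ) ≤ tensorRank (kroneckerPow (cwTensor ℂ q) N₀) := by
    exact_mod_cast one_le_tensorRank_kroneckerPow_cwTensor q N₀ hq1
  have hR0 : (0 : ℝ) ≤ tensorRank (kroneckerPow (cwTensor ℂ q) N₀) := by linarith
  have h := CoppersmithWinograd1990_rank_form_holds q N₀ hq hN₀
  change omega ℂ ≤ Real.logb q ((4 / 27) *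
    ((tensorRank (kroneckerPow (cwTensor ℂ q) N₀) : ℝ) ^ ((3 : ℝ) / N₀))) at h
  have hq1' : (1 : ℝ) < q := by exact_mod_cast hq
  have hpos : (0 : ℝ) < (4 / 27) *
      (tensorRank (kroneckerPow (cwTensor ℂ q) N₀) : ℝ) ^ ((3 : ℝ) / N₀) :=
    mul_pos (by norm_num) (Real.rpow_pos_of_pos (by linarith) _)
  refine h.trans (Real.logb_le_logb_of_le hq1' hpos ?_)
  have hN0 : (N₀ : ℝ) ≠ 0 := by exact_mod_cast (by omega : N₀ ≠ 0)
  have hexp : (tensorRank (kroneckerPow (cwTensor ℂ q) N₀) : ℝ) ^ ((3 : ℝ) / N₀) ≤ ρ ^ 3 := by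
    calc (tensorRank (kroneckerPow (cwTensor ℂ q) N₀) : ℝ) ^ ((3 : ℝ) / N₀)
        ≤ (ρ ^ N₀) ^ ((3 : ℝ) / N₀) := Real.rpow_le_rpow hR0 hR (by positivity)
      _ = ρ ^ 3 := by
          rw [← Real.rpow_natCast ρ N₀, ← Real.rpow_mul hρ0.le,
            show (N₀ : ℝ) * ((3 : ℝ) / N₀) = ((3 : ℕ) : ℝ) by push_cast; field_simp,
            Real.rpow_natCast]
  nlinarith [hexp]

/-! ## The door -/

/-- **The door, exponent form**: `R̃(T_cw,2) ≤ 3 ⇒ ω(ℂ) ≤ 2`. For every `η > 0` take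
`ρ = 3·2^{η/3} > 3 ≥ R̃`; then `log₂(4ρ³/27) = 2 + η`.
[cite: ConnerGesmundoLandsbergVentura2022, p. 3 ("were `R̃(T_cw,2) = 3` … `ω = 2`")] -/
theorem omega_le_two_of_asymptoticRank_cwTensor_two_le_three
    (h : asymptoticRank (cwTensor ℂ 2) ≤ 3) : omega ℂ ≤ 2 := by
  refine le_of_forall_pos_le_add fun η hη => ?_
  have h2 : (1 : ℝ) < (2 : ℝ) ^ (η / 3) := Real.one_lt_rpow (by norm_num) (by positivity)
  have hρ3 : (3 : ℝ) < 3 * (2 : ℝ) ^ (η / 3) := by linarith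
  have hA := omega_le_logb_of_asymptoticRank_cwTensor_lt (le_refl 2) (lt_of_le_of_lt h hρ3)
  have hcube : (3 * (2 : ℝ) ^ (η / 3)) ^ 3 = 27 * (2 : ℝ) ^ η := by
    rw [mul_pow]
    have e : ((2 : ℝ) ^ (η / 3)) ^ 3 = (2 : ℝ) ^ η := by
      rw [← Real.rpow_natCast, ← Real.rpow_mul (by norm_num : (0 : ℝ) ≤ 2)]
      congr 1
      push_cast
      ring
    rw [e]
    norm_num
  have hval : Real.logb 2 (4 * (3 * (2 : ℝ) ^ (η / 3)) ^ 3 / 27) = 2 + η := by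
    rw [hcube]
    have e : (4 : ℝ) * (27 * (2 : ℝ) ^ η) / 27 = (2 : ℝ) ^ ((2 : ℝ) + η) := by
      rw [Real.rpow_add (by norm_num : (0 : ℝ) < 2), Real.rpow_two]
      ring
    rw [e, Real.logb_rpow (by norm_num) (by norm_num)]
  rw [Nat.cast_ofNat, hval] at hA
  exact hA

/-- **The door**: `R̃(T_cw,2) ≤ 3 ⇒ MatrixMultiplication` (`ω(ℂ) = 2`, the summit statement), with
`2 ≤ ω(ℂ)` from the flattening bound (`omega_two_le`). Unconditional: both literature inputs
(Coppersmith–Winograd's laser-method bound, `ω ≥ 2`) are proved in the tree.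
[cite: ConnerGesmundoLandsbergVentura2022, Thm. 1.1 and p. 3] -/
theorem matrixMultiplication_of_asymptoticRank_cwTensor_two_le_three
    (h : asymptoticRank (cwTensor ℂ 2) ≤ 3) : _root_.MatrixMultiplication :=
  _root_.MatrixMultiplication_iff.2
    (le_antisymm (omega_le_two_of_asymptoticRank_cwTensor_two_le_three h) (omega_two_le ℂ))

/-! ## Spectral form -/

/-- For any bound `r`: every universal spectral point is `≤ r` at `T_cw,2` iff `R̃(T_cw,2) ≤ r`
(Strassen duality `R̃ = max_{Δ} F`, proved in the tree). [cite: ChristandlVranaZuiddam2023, Prop. 1.6] -/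
theorem forall_spectralPoint_cwTensor_two_le_iff (r : ℝ) :
    (∀ F, IsUniversalSpectralPoint ℂ F → F (cwTensor ℂ 2) ≤ r) ↔
      asymptoticRank (cwTensor ℂ 2) ≤ r := by
  constructor
  · exact strassen_duality_asymptoticRank.asymptoticRank_le
      (strassen_duality_asymptoticRank_holds ℂ) (cwTensor ℂ 2)
  · intro h F hF
    exact ((strassen_duality_asymptoticRank_holds ℂ (cwTensor ℂ 2)).1 F hF).trans h

/-- **The door, spectral form**: if no point of the asymptotic spectrum `Δ(T(ℂ))` exceeds `3` at
`T_cw,2` — i.e. no universal spectral point separates `T_cw,2` from the unit tensor `⟨3⟩` from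
above — then `ω = 2`. (Every spectral point CONSTRUCTED so far, the gauge points and the quantum
functionals, equals `3` at `T_cw,2`; the door is the assertion that the unknown part of `Δ` does too.)
[cite: ChristandlVranaZuiddam2023, Prop. 1.6] [cite: ConnerGesmundoLandsbergVentura2022, p. 3] -/
theorem matrixMultiplication_of_forall_spectralPoint_cwTensor_two_le_three
    (h : ∀ F, IsUniversalSpectralPoint ℂ F → F (cwTensor ℂ 2) ≤ 3) : _root_.MatrixMultiplication :=
  matrixMultiplication_of_asymptoticRank_cwTensor_two_le_three
    ((forall_spectralPoint_cwTensor_two_le_iff 3).1 h)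

/-! ## Where the door sits: `√6 ≤ Q̃(T_cw,2) ≤ 3 ≤ R̃(T_cw,2) ≤ 4` -/

/-- `3 ≤ R̃(T_cw,2)` over every field: the flattening rank of `T_cw,2` is `3`
(`flatteningRank_cwTensor`) and `ζ⁽¹⁾ ≤ R̃`. So the door asks for `R̃(T_cw,2) = 3` exactly.
[cite: ChristandlVranaZuiddam2023, Example 1.4] -/
private theorem three_le_asymptoticRank_cwTensor_two_flat {K : Type} [Field K] :
    (3 : ℝ) ≤ asymptoticRank (cwTensor K 2) := by
  have h := flatteningRank_le_asymptoticRank (cwTensor K 2)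
  rw [flatteningRank_cwTensor (by norm_num : 1 ≤ 2)] at h
  exact_mod_cast h

/-- The door's hypothesis is equivalently the equality `R̃(T_cw,2) = 3`. [folklore] -/
theorem asymptoticRank_cwTensor_two_le_three_iff :
    asymptoticRank (cwTensor ℂ 2) ≤ 3 ↔ asymptoticRank (cwTensor ℂ 2) = 3 :=
  ⟨fun h => le_antisymm h three_le_asymptoticRank_cwTensor_two_flat, fun h => h.le⟩

/-- `R̃(T_cw,2) ≤ 4` in the kernel: `R̃ ≤ bR` (`asymptoticRank_le_algBorderRank`) and
`bR(T_cw,2) ≤ 4` (Coppersmith–Winograd's `q + 2 = 4` approximate products,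
`algBorderRank_cwTensor_le`). In print the record is `R̃(T_cw,2) ≤ 3.9310`
(Alman–Li 2026, Thm. 1.3), not formalised. [cite: BurgisserClausenShokrollahi1997, Lemma (15.27)] -/
private theorem asymptoticRank_cwTensor_two_le_four_cw : asymptoticRank (cwTensor ℂ 2) ≤ 4 := by
  have h := asymptoticRank_le_algBorderRank (cwTensor ℂ 2)
  have h4 : algBorderRank (cwTensor ℂ 2) ≤ 2 + 2 := algBorderRank_cwTensor_le ℂ 2
  have h4' : (algBorderRank (cwTensor ℂ 2) : ℝ) ≤ 4 := by exact_mod_cast h4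
  exact h.trans h4'

/-- `Q̃(T_cw,2) ≤ 3` (flattening bound `Q̃ ≤ |ι|`, via the proved subrank duality).
[cite: ChristandlVranaZuiddam2023, Prop. 1.6] -/
theorem asymptoticSubrank_cwTensor_two_le_three : asymptoticSubrank ℂ (cwTensor ℂ 2) ≤ 3 := by
  have h := (asymptoticSubrank_le_card₁₂₃ (cwTensor ℂ 2)).1
  rw [Fintype.card_fin] at h
  exact_mod_cast h

/-- **The sandwich around the door** (kernel values): `√6 ≤ Q̃(T_cw,2) ≤ 3 ≤ R̃(T_cw,2) ≤ 4`; the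
summit follows from closing the third inequality to an equality from above.
(`√6` = the zeroing-out certificate `Q(T_cw,2^{⊠2}) ≥ 6` of `SoloInformedCwTwoSubrank.lean`;
on paper `Q̃(T_cw,2) = 3` by Strassen's support functionals / BCS Thm. (15.39), not formalised.)
[cite: BurgisserClausenShokrollahi1997, Thm. (15.39), Ex. 15.24(7)] -/
theorem cwTensor_two_spectral_sandwich :
    (6 : ℝ) ^ ((1 : ℝ) + 1)⁻¹ ≤ asymptoticSubrank ℂ (cwTensor ℂ 2) ∧
      asymptoticSubrank ℂ (cwTensor ℂ 2) ≤ 3 ∧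
      (3 : ℝ) ≤ asymptoticRank (cwTensor ℂ 2) ∧ asymptoticRank (cwTensor ℂ 2) ≤ 4 :=
  ⟨rpow_six_half_le_asymptoticSubrank_cwTensor_two, asymptoticSubrank_cwTensor_two_le_three,
    three_le_asymptoticRank_cwTensor_two_flat, asymptoticRank_cwTensor_two_le_four_cw⟩

end Summit.MatrixMultiplication.MatrixMultiplication.Theorems

end
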